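/-
Copyright: b2b-lace packet (carver, gen 52).  [NoBLE17] §5.3.2 (5.40) / [FvdH17] §4.2 (4.16), (4.18): the ENTRY
INEQUALITIES for the six in-point sums of the repulsive bubble letter `𝓑_{j₁,j₂}(y,v)` with the out-point `v` at the
origin, at a unit vector, or free, over the tree objects `Letters.perc` (`NoblePercLetters`), `kdc`, `twoDD`
(`NobleBlocks`) and the landed slot bound `sum_perc_B_toReal_le_slots` (`NoblePercLettersDict`).  Proofs only; no
named fact; no numeral; no dimension.
-/
import Literature.Probability.FitznerVanDerHofstad2017.NoblePercLettersDict
import Literature.Probability.FitznerVanDerHofstad2017.NobleElementsClosedFormsRows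
import HarnessLib

/-!
# [NoBLE17] (5.40) at the bubble-letter sums `sup_v w(v)·Σ_{y ≠ 0} 𝓑_{j₁,≥1}(y,v)`, `j₁ ∈ {1̲, ≥2}`, `w = 𝟙{|v| = 1}` or `w = 1`

CITATION HEADER (PLACEMENT v2). This module is part of a certified REPRODUCTION of:
R. Fitzner, R. van der Hofstad, *Generalized approach to the non-backtracking lace expansion*, Probab. Theory Related
Fields **169** (2017) 1041–1119 [NoBLE17], §5.3.2 "Bounds on simple diagrams", display (5.40) (PTRF p. 1098:
`Σ_y 𝓑_{m₁,m₂}(y,x) ≤ Σ_{L=m₁+m₂}^{M−1} (L+1−m₁−m₂) c_L(x) p^L + (M−m₁−m₂) p^M Γ̄₂ R₁ + p^M Γ̄₂² R₂`, the repulsive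
bubble summed over its middle point, with `c_L(x)` the number of `L`-step bond-self-avoiding walks from `0` to `x` and
`R₁, R₂` the remainder-kernel constants of the first display of §5.3.2, p. 1097), and of
R. Fitzner, R. van der Hofstad, *Mean-field behavior for nearest-neighbor percolation in `d > 10`*, Electron. J.
Probab. **22** (2017) no. 43 [FvdH17] (extended version arXiv:1506.07977v2), §4.2 (4.16) (p. 36: the repulsive bubble
letter `𝓑_{j₁,j₂}(x₁,x₂) = max_i ℙ^{(x)2}(…)`), (4.18) and the display after it (p. 36: how such letters are bounded
"using the ideas of [NoBLE, Section 5.3]"), and §5.1 (5.1) / App. B Table B.2 rows `(1,·)`, `(2,·)` (pp. 49, 73: the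
out-point `v` of a block is `0`, a unit vector `e_ι` — weight `𝟙{|v| = 1}` — or free, and the matrix norms take the
supremum over it).  Origin: build `lace` (host summit CriticalPhenomena), carver seat; node N76-X2-D77 of the cell's
lemma DAG, leaves D♯(c,b), c ∈ {1,2} (the four out-point-supremum entry inequalities a Summit-side consumer rewrites
rows 1–2 of its `x = 0` slice matrix into; the row `c = 0` — out-point at the origin, printed constants — is the sibling module
of Lean typing seat 1, and is here only the generic passage `tsum_kdc_perc_B_ge_le_ofReal` at `X = {0}`).

WHAT THIS FILE DOES.  For the instance `L = Letters.perc d p` the letter at at-least indices is the repulsive bubble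
diagram (`NoblePercLettersDict.perc_B_ge`), and [NoBLE17] (5.40) is landed for it over any finite set of middle
points and any endpoint set `X ∋ x` carrying remainder-kernel constants (`sum_perc_B_toReal_le_slots`).  This module
packages that bound in the three shapes a matrix-norm consumer needs, with the trail-word count read through a
majorant `N L ≥ #trailWordsTo d L x` on the endpoint set in play (so that the right-hand side is ONE total real
function `bubbleSlotR p Γ̄₂ m₁ m₂ M N R₁ R₂` per shape):

* `bubbleSlotR` — the right-hand side of (5.40) as a total real function; `bubbleSlotR_mono_count`, `bubbleSlotR_nonneg`;
* `tsum_kdc_perc_B_ge_le_ofReal` — **the generic passage**: `Σ'_y (1−δ_{y,0}) 𝓑_{≥m₁,≥m₂}(y,x) ≤ ofReal (bubbleSlotR …)`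
  for `x ∈ X`, from the finite partial sums (`ENNReal.tsum_eq_iSup_sum`);
* `tsum_kdc_perc_B_eq_one_le_ofReal` — the same with first index `1̲` (through `perc_B_le_floor`: a line of length exactly
  `1` is a line of length `≥ 1`);
* out-point free (`⨆_v`): `iSup_tsum_kdc_perc_B_ge_two_one_le`, `iSup_tsum_kdc_perc_B_eq_one_ge_one_le` — the bound is
  `max` of the closed instance (`v = 0`, endpoint set `{0}`) and the open one (`v ≠ 0`, endpoint set `{x ≠ 0}`), because
  the two endpoint classes carry different trail-word counts and kernel constants;
* out-point a unit vector (`⨆_v 𝟙{v = e_ι} · …`): `iSup_twoDD_tsum_kdc_perc_B_ge_two_one_le`,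
  `iSup_twoDD_tsum_kdc_perc_B_eq_one_ge_one_le` — endpoint set `range stepVec` (`twoDD_stepVec`, `twoDD_of_not_exists`).

Any `d ≥ 2`, `p < p_c(d)`; nothing landed is modified; no cited hypothesis — every statement is a kernel-proved
inequality between landed definitions, with the count majorant and the kernel constants as explicit hypotheses
(valid constants are KERNEL THEOREMS of `NbwRemainderFramePrinted`: `isRemKernelConst_srwK_univ/_single/_unitVecs/_of_le`).
The identification of `bubbleSlotR` at given `(d, M, N, R₁, R₂)` with the authors' notebook cells
(`Bound[Bubble,m,s]`, `Bound[OpenBubble,m,s]`, `Percolation.nb` cells 11–12) and every numerical reading are NOT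
part of this module.
-/

noncomputable section

namespace Literature.Probability.FitznerVanDerHofstad2017.NobleBlocks

open _root_.MeasureTheory Finset
open scoped BigOperators ENNReal
open Literature.Probability.LatticeModels Literature.Probability.Percolation
open Literature.Barriers.CriticalPhenomena
open Literature.Probability.FitznerVanDerHofstad2017

variable {d : ℕ}

/-! ## A. The (5.40) right-hand side as a total real function -/

/-- The right-hand side of [NoBLE17] (5.40) at line indices `(m₁, m₂)` and cut-off `M`, with the trail-word count read
through a majorant `N L` (`#{L-step bond-self-avoiding walks 0 → x} ≤ N L` on the endpoint set in play), `Γ̄ = Γ̄₂(p)`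
and remainder-kernel constants `R₁, R₂`:
`Σ_{L ∈ [m₁+m₂, M)} (L+1−m₁−m₂)·N L·p^L + (M−m₁−m₂)·p^M·Γ̄·R₁ + p^M·Γ̄²·R₂`.
[cite: FitznerVanDerHofstad2016NoBLE, §5.3.2 (5.40) (PTRF 169 (2017) p. 1098)] -/
def bubbleSlotR (p Γbar : ℝ) (m₁ m₂ M : ℕ) (N : ℕ → ℕ) (R₁ R₂ : ℝ) : ℝ :=
  (∑ L ∈ Finset.Ico (m₁ + m₂) M, ((L + 1 - m₁ - m₂ : ℕ) : ℝ) * (N L : ℝ) * p ^ L) +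
    ((M - m₁ - m₂ : ℕ) : ℝ) * (p ^ M * (Γbar * R₁)) + p ^ M * (Γbar ^ 2 * R₂)

/-- Monotonicity of the (5.40) right-hand side in the trail-word count (`#trailWordsTo d L x ≤ N L`, `0 ≤ p`).
[cite: FitznerVanDerHofstad2016NoBLE, §5.3.2 (5.40) (PTRF 169 (2017) p. 1098)] -/
theorem bubbleSlotR_mono_count {p Γbar : ℝ} (hp : 0 ≤ p) (m₁ m₂ M : ℕ) {x : Site d} {N : ℕ → ℕ}
    (hN : ∀ L, (trailWordsTo d L x).card ≤ N L) (R₁ R₂ : ℝ) :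
    (∑ L ∈ Finset.Ico (m₁ + m₂) M, ((L + 1 - m₁ - m₂ : ℕ) : ℝ) * ((trailWordsTo d L x).card : ℝ) * p ^ L) +
        ((M - m₁ - m₂ : ℕ) : ℝ) * (p ^ M * (Γbar * R₁)) + p ^ M * (Γbar ^ 2 * R₂) ≤
      bubbleSlotR p Γbar m₁ m₂ M N R₁ R₂ := by
  unfold bubbleSlotR
  gcongr with L hL
  exact_mod_cast hN L

/-- `0 ≤ bubbleSlotR` for non-negative `p, Γ̄, R₁, R₂` (the consumer's non-negativity side condition).
[cite: FitznerVanDerHofstad2016NoBLE, §5.3.2 (5.40) (PTRF 169 (2017) p. 1098)] -/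
theorem bubbleSlotR_nonneg {p Γbar : ℝ} (hp : 0 ≤ p) (hΓ : 0 ≤ Γbar) (m₁ m₂ M : ℕ) (N : ℕ → ℕ) {R₁ R₂ : ℝ}
    (hR₁ : 0 ≤ R₁) (hR₂ : 0 ≤ R₂) : 0 ≤ bubbleSlotR p Γbar m₁ m₂ M N R₁ R₂ := by
  unfold bubbleSlotR
  positivity

/-! ## B. The generic passage from finite middle-point sets to `∑'` -/

/-- **[NoBLE17] (5.40) for the instance's bubble letter, `∑'`/`ofReal` shape**: for `x ∈ X`,
`Σ'_y (1 − δ_{y,0}) 𝓑_{≥m₁,≥m₂}(y,x) ≤ ofReal (bubbleSlotR p Γ̄₂ m₁ m₂ M N R₁ R₂)` whenever `N` majorises the trail-word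
counts to `x` and `R₁, R₂` are remainder-kernel constants on `X` (`d ≥ 2`, `p < p_c`, `m₂ ≤ M`).  Every finite partial
sum is below the right-hand side by `sum_perc_B_toReal_le_slots`; the `∑'` is their supremum.
[cite: FitznerVanDerHofstad2016NoBLE, §5.3.2 (5.40) (PTRF 169 (2017) p. 1098)]
[cite: FitznerVanDerHofstad2017, §4.2 (4.16), (4.18) and the display after it (arXiv:1506.07977v2 p. 36)] -/
theorem tsum_kdc_perc_B_ge_le_ofReal (hd : 2 ≤ d) (p : unitInterval) (hp : p < criticalProbI d) {m₁ m₂ M : ℕ}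
    (hm : m₂ ≤ M) {x : Site d} {X : Set (Site d)} (hx : x ∈ X) {N : ℕ → ℕ} (hN : ∀ L, (trailWordsTo d L x).card ≤ N L)
    {R₁ R₂ : ℝ} (hR₁ : IsRemKernelConst d [M] X R₁) (hR₂ : IsRemKernelConst d [M - m₂, m₂] X R₂) :
    ∑' y, kdc y 0 * (Letters.perc d p).B (.ge m₁) (.ge m₂) y x ≤
      ENNReal.ofReal (bubbleSlotR p (nobleSup2 d p) m₁ m₂ M N R₁ R₂) := by
  rw [ENNReal.tsum_eq_iSup_sum]
  refine iSup_le fun S => ?_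
  have hB : ∀ y, kdc y 0 * (Letters.perc d p).B (.ge m₁) (.ge m₂) y x ≤
      ENNReal.ofReal (((Letters.perc d p).B (.ge m₁) (.ge m₂) y x).toReal) := by
    intro y
    rw [ENNReal.ofReal_toReal ((perc_B_le_one p _ _ _ _).trans_lt ENNReal.one_lt_top).ne]
    calc kdc y 0 * (Letters.perc d p).B (.ge m₁) (.ge m₂) y x
        ≤ 1 * (Letters.perc d p).B (.ge m₁) (.ge m₂) y x := by gcongr; exact kdc_le_one y 0
      _ = _ := one_mul _
  calc ∑ y ∈ S, kdc y 0 * (Letters.perc d p).B (.ge m₁) (.ge m₂) y x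
      ≤ ∑ y ∈ S, ENNReal.ofReal (((Letters.perc d p).B (.ge m₁) (.ge m₂) y x).toReal) :=
        Finset.sum_le_sum fun y _ => hB y
    _ = ENNReal.ofReal (∑ y ∈ S, ((Letters.perc d p).B (.ge m₁) (.ge m₂) y x).toReal) :=
        (ENNReal.ofReal_sum_of_nonneg fun y _ => ENNReal.toReal_nonneg).symm
    _ ≤ ENNReal.ofReal (bubbleSlotR p (nobleSup2 d p) m₁ m₂ M N R₁ R₂) :=
        ENNReal.ofReal_le_ofReal ((sum_perc_B_toReal_le_slots p hd hp hm hx hR₁ hR₂ S).trans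
          (bubbleSlotR_mono_count p.2.1 m₁ m₂ M hN R₁ R₂))

/-- The same passage with an exact first index `1̲`: a line of length exactly `1` is a line of length `≥ 1`
(`perc_B_le_floor`), so the `(1,m₂)` instance of (5.40) bounds `Σ'_y (1 − δ_{y,0}) 𝓑_{1̲,≥m₂}(y,x)`.
[cite: FitznerVanDerHofstad2016NoBLE, §5.3.2 (5.40) (PTRF 169 (2017) p. 1098)]
[cite: FitznerVanDerHofstad2017, §4.2 (4.12), (4.16) (arXiv:1506.07977v2 pp. 35–36)] -/
theorem tsum_kdc_perc_B_eq_one_le_ofReal (hd : 2 ≤ d) (p : unitInterval) (hp : p < criticalProbI d) {m₂ M : ℕ}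
    (hm : m₂ ≤ M) {x : Site d} {X : Set (Site d)} (hx : x ∈ X) {N : ℕ → ℕ} (hN : ∀ L, (trailWordsTo d L x).card ≤ N L)
    {R₁ R₂ : ℝ} (hR₁ : IsRemKernelConst d [M] X R₁) (hR₂ : IsRemKernelConst d [M - m₂, m₂] X R₂) :
    ∑' y, kdc y 0 * (Letters.perc d p).B (.eq 1) (.ge m₂) y x ≤
      ENNReal.ofReal (bubbleSlotR p (nobleSup2 d p) 1 m₂ M N R₁ R₂) :=
  (ENNReal.tsum_le_tsum fun y => mul_le_mul' le_rfl (perc_B_le_floor p (.eq 1) (.ge m₂) y x)).trans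
    (tsum_kdc_perc_B_ge_le_ofReal hd p hp hm hx hN hR₁ hR₂)

/-! ## C. Out-point free (row `c = 2`: supremum over `v`, split `v = 0 ∣ v ≠ 0`) -/

/-- **`sup_v Σ_{y ≠ 0} 𝓑_{≥2,≥1}(y,v) ≤ max (closed (5.40) at (2,1), open (5.40) at (2,1))`**: the member `v = 0` is the
closed instance (endpoint set `{0}`, counts `N₀`, constants `R₁, R₂`), every `v ≠ 0` the open one (endpoint set
`{x ≠ 0}`, counts `N₁` uniform on it, constants `R₁', R₂'`); `3 ≤ M`.
[cite: FitznerVanDerHofstad2016NoBLE, §5.3.2 (5.40) (PTRF 169 (2017) p. 1098)]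
[cite: FitznerVanDerHofstad2017, §4.2 (4.16); §5.1 (5.1) and App. B Table B.2 rows (2,·) (arXiv:1506.07977v2 pp. 36, 49, 73)] -/
theorem iSup_tsum_kdc_perc_B_ge_two_one_le (hd : 2 ≤ d) (p : unitInterval) (hp : p < criticalProbI d) {M : ℕ}
    (hM : 3 ≤ M) {N₀ N₁ : ℕ → ℕ} (hN₀ : ∀ L, (trailWordsTo d L (0 : Site d)).card ≤ N₀ L)
    (hN₁ : ∀ L (x : Site d), x ≠ 0 → (trailWordsTo d L x).card ≤ N₁ L) {R₁ R₂ R₁' R₂' : ℝ}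
    (hR₁ : IsRemKernelConst d [M] {(0 : Site d)} R₁) (hR₂ : IsRemKernelConst d [M - 1, 1] {(0 : Site d)} R₂)
    (hR₁' : IsRemKernelConst d [M] {x : Site d | x ≠ 0} R₁')
    (hR₂' : IsRemKernelConst d [M - 1, 1] {x : Site d | x ≠ 0} R₂') :
    (⨆ v, ∑' y, kdc y 0 * (Letters.perc d p).B (.ge 2) (.ge 1) y v) ≤
      ENNReal.ofReal (max (bubbleSlotR p (nobleSup2 d p) 2 1 M N₀ R₁ R₂)
        (bubbleSlotR p (nobleSup2 d p) 2 1 M N₁ R₁' R₂')) := by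
  refine iSup_le fun v => ?_
  by_cases hv : v = 0
  · subst hv
    exact (tsum_kdc_perc_B_ge_le_ofReal hd p hp (by omega) (Set.mem_singleton 0) hN₀ hR₁ hR₂).trans
      (ENNReal.ofReal_le_ofReal (le_max_left _ _))
  · exact (tsum_kdc_perc_B_ge_le_ofReal hd p hp (by omega) (X := {x : Site d | x ≠ 0}) hv
      (fun L => hN₁ L v hv) hR₁' hR₂').trans (ENNReal.ofReal_le_ofReal (le_max_right _ _))

/-- **`sup_v Σ_{y ≠ 0} 𝓑_{1̲,≥1}(y,v) ≤ max (closed (5.40) at (1,1), open (5.40) at (1,1))`** (`2 ≤ M`).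
[cite: FitznerVanDerHofstad2016NoBLE, §5.3.2 (5.40) (PTRF 169 (2017) p. 1098)]
[cite: FitznerVanDerHofstad2017, §4.2 (4.12), (4.16); §5.1 (5.1) and App. B Table B.2 rows (2,·) (arXiv:1506.07977v2 pp. 35–36, 49, 73)] -/
theorem iSup_tsum_kdc_perc_B_eq_one_ge_one_le (hd : 2 ≤ d) (p : unitInterval) (hp : p < criticalProbI d) {M : ℕ}
    (hM : 2 ≤ M) {N₀ N₁ : ℕ → ℕ} (hN₀ : ∀ L, (trailWordsTo d L (0 : Site d)).card ≤ N₀ L)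
    (hN₁ : ∀ L (x : Site d), x ≠ 0 → (trailWordsTo d L x).card ≤ N₁ L) {R₁ R₂ R₁' R₂' : ℝ}
    (hR₁ : IsRemKernelConst d [M] {(0 : Site d)} R₁) (hR₂ : IsRemKernelConst d [M - 1, 1] {(0 : Site d)} R₂)
    (hR₁' : IsRemKernelConst d [M] {x : Site d | x ≠ 0} R₁')
    (hR₂' : IsRemKernelConst d [M - 1, 1] {x : Site d | x ≠ 0} R₂') :
    (⨆ v, ∑' y, kdc y 0 * (Letters.perc d p).B (.eq 1) (.ge 1) y v) ≤
      ENNReal.ofReal (max (bubbleSlotR p (nobleSup2 d p) 1 1 M N₀ R₁ R₂)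
        (bubbleSlotR p (nobleSup2 d p) 1 1 M N₁ R₁' R₂')) := by
  refine iSup_le fun v => ?_
  by_cases hv : v = 0
  · subst hv
    exact (tsum_kdc_perc_B_eq_one_le_ofReal hd p hp (by omega) (Set.mem_singleton 0) hN₀ hR₁ hR₂).trans
      (ENNReal.ofReal_le_ofReal (le_max_left _ _))
  · exact (tsum_kdc_perc_B_eq_one_le_ofReal hd p hp (by omega) (X := {x : Site d | x ≠ 0}) hv
      (fun L => hN₁ L v hv) hR₁' hR₂').trans (ENNReal.ofReal_le_ofReal (le_max_right _ _))

/-! ## D. Out-point a unit vector (row `c = 1`: weight `𝟙{v = e_ι}`, endpoint set `range stepVec`) -/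

/-- **`sup_v 𝟙{|v| = 1}·Σ_{y ≠ 0} 𝓑_{≥2,≥1}(y,v) ≤ (5.40) at (2,1) on the unit vectors`**: counts `N` majorising the
trail words to every `e_ι`, kernel constants on `range stepVec` (e.g. `isRemKernelConst_srwK_unitVecs`); `3 ≤ M`.
[cite: FitznerVanDerHofstad2016NoBLE, §5.3.2 (5.40) (PTRF 169 (2017) p. 1098)]
[cite: FitznerVanDerHofstad2017, §4.2 (4.16); §5.1 (5.1) and App. B Table B.2 rows (1,·) (arXiv:1506.07977v2 pp. 36, 49, 73)] -/
theorem iSup_twoDD_tsum_kdc_perc_B_ge_two_one_le (hd : 2 ≤ d) (p : unitInterval) (hp : p < criticalProbI d)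
    {M : ℕ} (hM : 3 ≤ M) {N : ℕ → ℕ} (hN : ∀ L (ι : Fin d × Bool), (trailWordsTo d L (stepVec ι : Site d)).card ≤ N L)
    {R₁ R₂ : ℝ} (hR₁ : IsRemKernelConst d [M] (Set.range fun ι : Fin d × Bool => (stepVec ι : Site d)) R₁)
    (hR₂ : IsRemKernelConst d [M - 1, 1] (Set.range fun ι : Fin d × Bool => (stepVec ι : Site d)) R₂) :
    (⨆ v, twoDD v * ∑' y, kdc y 0 * (Letters.perc d p).B (.ge 2) (.ge 1) y v) ≤
      ENNReal.ofReal (bubbleSlotR p (nobleSup2 d p) 2 1 M N R₁ R₂) := by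
  refine iSup_le fun v => ?_
  by_cases hv : ∃ ι : Fin d × Bool, v = stepVec ι
  · obtain ⟨ι, rfl⟩ := hv
    rw [twoDD_stepVec, one_mul]
    exact tsum_kdc_perc_B_ge_le_ofReal hd p hp (by omega) (Set.mem_range_self ι) (hN · ι) hR₁ hR₂
  · rw [twoDD_of_not_exists hv, zero_mul]
    exact bot_le

/-- **`sup_v 𝟙{|v| = 1}·Σ_{y ≠ 0} 𝓑_{1̲,≥1}(y,v) ≤ (5.40) at (1,1) on the unit vectors`** (`2 ≤ M`).
[cite: FitznerVanDerHofstad2016NoBLE, §5.3.2 (5.40) (PTRF 169 (2017) p. 1098)]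
[cite: FitznerVanDerHofstad2017, §4.2 (4.12), (4.16); §5.1 (5.1) and App. B Table B.2 rows (1,·) (arXiv:1506.07977v2 pp. 35–36, 49, 73)] -/
theorem iSup_twoDD_tsum_kdc_perc_B_eq_one_ge_one_le (hd : 2 ≤ d) (p : unitInterval) (hp : p < criticalProbI d)
    {M : ℕ} (hM : 2 ≤ M) {N : ℕ → ℕ} (hN : ∀ L (ι : Fin d × Bool), (trailWordsTo d L (stepVec ι : Site d)).card ≤ N L)
    {R₁ R₂ : ℝ} (hR₁ : IsRemKernelConst d [M] (Set.range fun ι : Fin d × Bool => (stepVec ι : Site d)) R₁)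
    (hR₂ : IsRemKernelConst d [M - 1, 1] (Set.range fun ι : Fin d × Bool => (stepVec ι : Site d)) R₂) :
    (⨆ v, twoDD v * ∑' y, kdc y 0 * (Letters.perc d p).B (.eq 1) (.ge 1) y v) ≤
      ENNReal.ofReal (bubbleSlotR p (nobleSup2 d p) 1 1 M N R₁ R₂) := by
  refine iSup_le fun v => ?_
  by_cases hv : ∃ ι : Fin d × Bool, v = stepVec ι
  · obtain ⟨ι, rfl⟩ := hv
    rw [twoDD_stepVec, one_mul]
    exact tsum_kdc_perc_B_eq_one_le_ofReal hd p hp (by omega) (Set.mem_range_self ι) (hN · ι) hR₁ hR₂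
  · rw [twoDD_of_not_exists hv, zero_mul]
    exact bot_le

end Literature.Probability.FitznerVanDerHofstad2017.NobleBlocks

end
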